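import Summits.ABC.IUTFork.Joshi.ArithmeticoidsNumberFieldModel
import Summits.ABC.IUTFork.Joshi.ArithmeticoidFrobenioids
import HarnessLib

/-!
# The arithmetic model of `ATS2h.DeformationDatum` RE-BASED to [J-2½] Def. 4.1.1: `Prop5151v2` FAILS there —
# half (a) of an honest non-vacuous verdict on [J-2½] Prop. 5.15.1 (block E, rung LADDER-ABC:A2.E, seat E-t48)

PROOF-SIDE companion of seat E-t37's object files `Joshi/Arithmeticoids.lean` (p430482) and seat E-t46's
`Joshi/ArithmeticoidFrobenioids.lean` (the claim-`Prop` `DeformationDatum.Prop5151v2` = K. Joshi, *Construction of Arithmetic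
Teichmüller Spaces II½*, arXiv:2305.10398 (unrefereed; bib `Joshi2023ATS2half`) Prop. 5.15.1, p.42 l.31–51: «there is a natural
isomorphism `Frob(arith(L)) ≃ Frob(L)^{pf}` of Frobenioids», typed coordinatewise at `v ∉ V^arc` as: the value group of the fibre
field `K_{y_v}` in log-coordinates EQUALS the divisible hull `ℚ·log|ι_{y_v}(L_v^×)|`), and of this seat's arithmetic model
`NumberFieldModel.model L` (p434710; every number field `L`, all places, Artin–Whaples absolute values, Mathlib's product formula).

STATE OF RECORD BEFORE THIS FILE: `Prop5151v2` is guarded by `IsDef411` (`base = algClosure`, Def. 4.1.1's `𝒴_L`) and both models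
of record are tagged `base := cp`, so it held VACUOUSLY at both (`Arithmeticoids2Model.toy_prop5151v2` p434058,
`NumberFieldModel.tower_prop5151v2` p436193) — no information.

THIS FILE (half (a) of the verdict pair designed by seat E-t46 g3, STATUS 2026-08-26T11:06:11Z; half (b) is the sibling file
`Joshi/ArithmeticoidsClosureFibresModel.lean`): the SAME arithmetic model with the single tag field re-set to `base := algClosure`
(`modelDef411`; the 27 other fields are those of `model L` verbatim, so every arithmetic verdict of p434710 transfers) satisfies
`IsDef411` and makes `Prop5151v2` FALSE for EVERY number field `L` (`not_modelDef411_prop5151v2`): at a finite place `v = 𝔭` the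
fibre field of the model is `K_{y_v} = L_v` itself, whose value group `N𝔭^ℤ` is NOT 2-divisible — the element `½·log|π_v|_v`
(`π_v` a uniformiser, `q = ½` in the typed right-hand side) is not a `log|x|_v`. READING (typing observation, no adjudication):
`Prop5151v2` is NOT a consequence of the 28-field signature `DeformationDatum` even under `IsDef411`; what decides it is whether
`|K_{y_v}^×|` is the divisible hull of `|L_v^×|`, i.e. print's standing hypothesis that `K_{y_v}` is an ALGEBRAICALLY CLOSED
(perfectoid) field (Def. 5.1.1, [Scholze 2012] as quoted p.42 l.18–22) — a hypothesis the signature's docstring mentions but no field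
records. The sibling file (b) shows the typed claim HOLDS once the fibres are algebraic closures with the extended absolute value.
No side taken on [IUTchIII] Cor. 3.12 or on any author; typed ≠ proved; a model exhibits (non-)derivability, nothing more. Everything
here is [folklore] (discreteness of `|L_v^×|`); `[claim: Joshi2023ATS2half, status: disputed]` tags only the quoted claim-`Prop`.
-/

noncomputable section

open NumberField IsDedekindDomain

namespace Summit.ABC.IUTFork.Joshi.ATS2h

namespace NumberFieldModel

variable (L : Type) [Field L] [NumberField L]

/-! ## 1. Finite places: values are integral powers of `N𝔭` -/

/-- A number field has a finite place (`𝓞 L` is not a field, so it has a maximal ideal `≠ ⊥`). [folklore] -/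
theorem nonempty_finitePlace : Nonempty (FinitePlace L) := by
  obtain ⟨M, hM⟩ := Ideal.exists_maximal (𝓞 L)
  exact ⟨FinitePlace.mk ⟨M, hM.isPrime, Ring.ne_bot_of_isMaximal_of_not_isField hM (RingOfIntegers.not_isField L)⟩⟩

/-- `N𝔭_w > 1` as a real number. [folklore] -/
theorem one_lt_absNorm_real (w : FinitePlace L) : (1 : ℝ) < (Ideal.absNorm w.maximalIdeal.asIdeal : ℝ) := by
  exact_mod_cast NumberField.HeightOneSpectrum.one_lt_absNorm w.maximalIdeal

/-- The values of a finite place on `L^×` are INTEGRAL powers of `N𝔭_w` (`|x|_w = N𝔭_w^{-ord_w x}`). [folklore] -/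
theorem exists_apply_eq_absNorm_zpow (w : FinitePlace L) {x : L} (hx : x ≠ 0) :
    ∃ m : ℤ, w x = (Ideal.absNorm w.maximalIdeal.asIdeal : ℝ) ^ m := by
  have hv : w.maximalIdeal.valuation L x ≠ 0 := (Valuation.ne_zero_iff _).2 hx
  refine ⟨Multiplicative.toAdd (WithZero.unzero hv), ?_⟩
  rw [← FinitePlace.norm_embedding_eq, FinitePlace.norm_embedding', WithZeroMulInt.toNNReal_neg_apply _ hv]
  push_cast
  rfl

/-- A uniformiser: some `π ∈ L` has `|π|_w = N𝔭_w⁻¹`. [folklore] -/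
theorem exists_apply_eq_absNorm_inv (w : FinitePlace L) :
    ∃ π : L, w π = (Ideal.absNorm w.maximalIdeal.asIdeal : ℝ)⁻¹ := by
  obtain ⟨π, hπ⟩ := w.maximalIdeal.valuation_exists_uniformizer L
  have hv : w.maximalIdeal.valuation L π ≠ 0 := by rw [hπ]; exact WithZero.exp_ne_zero
  refine ⟨π, ?_⟩
  have hm : Multiplicative.toAdd (WithZero.unzero hv) = -1 := by
    rw [WithZero.toAdd_unzero_eq_iff]
    exact hπ
  rw [← FinitePlace.norm_embedding_eq, FinitePlace.norm_embedding', WithZeroMulInt.toNNReal_neg_apply _ hv, hm]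
  push_cast
  rw [zpow_neg, zpow_one]

/-- DISCRETENESS: `½·log|π|_w` is not a value `log|x|_w`, `x ∈ L^×` (`N𝔭^ℤ` is not 2-divisible). [folklore] -/
theorem half_log_uniformizer_ne_log (w : FinitePlace L) {π : L} (hπ : w π = (Ideal.absNorm w.maximalIdeal.asIdeal : ℝ)⁻¹)
    {x : L} (hx : x ≠ 0) : Real.log (w x) ≠ (1 / 2 : ℝ) * Real.log (w π) := by
  obtain ⟨m, hm⟩ := exists_apply_eq_absNorm_zpow L w hx
  have hN := one_lt_absNorm_real L w
  have hlog : 0 < Real.log (Ideal.absNorm w.maximalIdeal.asIdeal : ℝ) := Real.log_pos hN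
  rw [hm, hπ, Real.log_zpow, Real.log_inv]
  intro h
  have h2 : ((2 * m + 1 : ℤ) : ℝ) * Real.log (Ideal.absNorm w.maximalIdeal.asIdeal : ℝ) = 0 := by
    push_cast
    linarith
  rcases mul_eq_zero.1 h2 with h3 | h3
  · have h4 : (2 * m + 1 : ℤ) = 0 := by exact_mod_cast h3
    omega
  · exact hlog.ne' h3

/-! ## 2. The arithmetic model re-based to Def. 4.1.1 -/

/-- **The arithmetic model of p434710 RE-BASED to [J-2½] Def. 4.1.1** (`base := algClosure`, i.e. the datum is read as `𝒴_L`
proper): the 27 other fields are `NumberFieldModel.model L` VERBATIM (all places of `L`, Artin–Whaples `|−|_v`, Mathlib's product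
formula, `Y_v = ℤ` one Frobenius orbit, fibres `K_{y_n} = L_v` with `|−|_v^{p_v^n}`, `α_v(y_n) = p_v^{−n}`). The tag `base` is
read by no other field of the signature, so this is as genuine a datum as `model L`. [folklore] -/
def modelDef411 : DeformationDatum L (Place L) (Loc L) (fun _ => ℤ) (fun v _ => Loc L v) (fun _ => Unit) (fun _ => Unit) :=
  { model L with base := TiltBase.algClosure }

/-- The re-based model IS a Def. 4.1.1 datum (`IsDef411`), so `Prop5151v2` is no longer vacuous at it. [folklore] -/
theorem modelDef411_isDef411 : (modelDef411 L).IsDef411 := rfl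

/-- Unfolding: the fibre absolute value of the re-based model is `|−|_v^{p_v^n}`. [folklore] -/
theorem modelDef411_absK (v : Place L) (n : ℤ) (z : Loc L v) :
    (modelDef411 L).absK v n z = absLoc L v z ^ ((resChar L v : ℝ) ^ n) := rfl

/-- Unfolding: at the point `n = 0` the fibre absolute value is `|−|_v` itself. [folklore] -/
theorem modelDef411_absK_zero (v : Place L) (z : Loc L v) : (modelDef411 L).absK v 0 z = absLoc L v z := by
  rw [modelDef411_absK, zpow_zero, Real.rpow_one]

/-- Unfolding: the untilt structure map of the re-based model is the identity of `L_v`. [folklore] -/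
theorem modelDef411_emb (v : Place L) (n : ℤ) : (modelDef411 L).emb v n = RingHom.id (Loc L v) := rfl

/-- `|z|_v = w(z)` at a finite place `v = w`, for `z ∈ L_v = (L, |−|_w)`. [folklore] -/
theorem absLoc_inr (w : FinitePlace L) (z : Loc L (Sum.inr w)) : absLoc L (Sum.inr w) z = w (WithAbs.equiv _ z) :=
  absLoc_toLoc_inr L w (WithAbs.equiv _ z)

/-! ## 3. Verdict: `Prop5151v2` FAILS at the re-based arithmetic model -/

/-- **[J-2½] Prop. 5.15.1 as typed (`Prop5151v2`) FAILS at the Def. 4.1.1-based arithmetic model, for EVERY number field `L`.**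
At the point `y = (y⁰_v)_v` (`n = 0` in every Frobenius orbit) and any finite place `v = 𝔭`: the typed right-hand side
`{q·log|ι(x)|_{K} : x ∈ L_v^×, q ∈ ℚ}` contains `½·log|π_v|_v`, which is not in the value group `log|K_{y_v}^×| = log|L_v^×| =
ℤ·log N𝔭` (`half_log_uniformizer_ne_log`). Hence `Prop5151v2` is NOT derivable from the signature `DeformationDatum` + `IsDef411`:
the deciding datum — divisibility of `|K_{y_v}^×|`, i.e. `K_{y_v}` algebraically closed — is not a field of the signature (half (b),
where it is supplied, is `Joshi/ArithmeticoidsClosureFibresModel.lean`). [claim: Joshi2023ATS2half, status: disputed] -/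
theorem not_modelDef411_prop5151v2 : ¬ (modelDef411 L).Prop5151v2 := by
  intro h
  obtain ⟨w⟩ := nonempty_finitePlace L
  obtain ⟨π, hπ⟩ := exists_apply_eq_absNorm_inv L w
  have hN := one_lt_absNorm_real L w
  have hπ0 : π ≠ 0 := by
    intro h0
    rw [h0, map_zero] at hπ
    exact (inv_pos.2 (zero_lt_one.trans hN)).ne hπ
  have hπ0' : toLoc L (Sum.inr w) π ≠ 0 := (map_ne_zero_iff _ (toLoc L (Sum.inr w)).injective).2 hπ0
  have hS := h (modelDef411_isDef411 L) (fun _ => (0 : ℤ)) (Sum.inr w) (inr_notMem_arch L w)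
  have hmem : (1 / 2 : ℝ) * Real.log ((modelDef411 L).absK (Sum.inr w) 0
      ((modelDef411 L).emb (Sum.inr w) 0 (toLoc L (Sum.inr w) π))) ∈
      ((modelDef411 L).logValueGroup (fun _ => (0 : ℤ)) (Sum.inr w) : Set ℝ) := by
    rw [hS]
    exact ⟨Units.mk0 _ hπ0', (1 / 2 : ℚ), by push_cast; rfl⟩
  obtain ⟨x, hx⟩ := hmem
  have hx0 : WithAbs.equiv _ (x : Loc L (Sum.inr w)) ≠ 0 := by
    rw [map_ne_zero_iff _ (WithAbs.equiv _).injective]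
    exact x.ne_zero
  have hπv : absLoc L (Sum.inr w) (toLoc L (Sum.inr w) π) = w π := absLoc_toLoc_inr L w π
  change Real.log ((modelDef411 L).absK (Sum.inr w) 0 (x : Loc L (Sum.inr w))) = _ at hx
  rw [modelDef411_absK_zero, modelDef411_absK_zero, modelDef411_emb, RingHom.id_apply, absLoc_inr, hπv] at hx
  exact half_log_uniformizer_ne_log L w hπ hx0 hx

/-- The verdicts of p434710 that do not read `base` transfer verbatim to the re-based model: Thm. 4.2.3 (4)
`LActsByFrobeniusPowers` HOLDS (by construction of `act`). [claim: Joshi2023ATS2half, status: disputed] -/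
theorem modelDef411_lActsByFrobeniusPowers : (modelDef411 L).LActsByFrobeniusPowers :=
  model_lActsByFrobeniusPowers L

/-- … Thm. 5.10.1 (7) `PeriodMapNonconstant` HOLDS at the re-based model (same proof term as p434710's
`model_periodMapNonconstant`). [claim: Joshi2023ATS2half, status: disputed] -/
theorem modelDef411_periodMapNonconstant : (modelDef411 L).PeriodMapNonconstant :=
  model_periodMapNonconstant L

/-- … and Thm. 5.5.2 (7) `Thm552_7` FAILS at the re-based model (y-independent fibre types, as at p434710).
[claim: Joshi2023ATS2half, status: disputed] -/
theorem not_modelDef411_thm552_7 : ¬ (modelDef411 L).Thm552_7 :=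
  not_model_thm552_7 L

end NumberFieldModel

end Summit.ABC.IUTFork.Joshi.ATS2h

end
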